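import Mathlib
import HarnessLib
import Summits.HubbardSuperconductivity.HubbardSuperconductivity.Theorems.KLProgrammeKLRegimeEngineFrameShiftDressingSup
import Summits.HubbardSuperconductivity.HubbardSuperconductivity.Theorems.KLProgrammeKLRegimeEngineFrameShiftDressingSymbols
import Summits.HubbardSuperconductivity.HubbardSuperconductivity.Theorems.KLProgrammeKLRegimeEngineFrameShiftResponseDoorCTMismatchFlow
import Summits.HubbardSuperconductivity.HubbardSuperconductivity.Theorems.KLProgrammeKLRegimeEngineFrameShiftDressingSupFlow
import Summits.HubbardSuperconductivity.HubbardSuperconductivity.Theorems.KLProgrammeKLRegimeEngineFrameShiftResponseDoorCTMismatchFlowPure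

/-!
# K3 gen-8-FLOW (stmt 20437, stub (C), located «(B)-MAIN-UNPRIMED», cure «(B)-MAIN-PURE»): the (B) door with the tree/dressing jets on the SUP/ALIASING route — PURE tower moments (cell gate-hubbard-kl, seat p2 g22)

Twin of `…KLProgrammeKLRegimeEngineFrameShiftDressingSupFlow.norm_iteratedFDeriv_klLocSelfEnergyRe_flowFrame_sub_le_aliasing` with the ONE tower input `N` (pinned moments of `𝔉⁻¹` of the FOUR-leg kernel at the loop strings) asked in the
PURE weight `(|x̃₀|+|x̃₁|)ʲ` — zero at the local vertex for `j ≥ 1` — instead of `(1+|x̃₀|+|x̃₁|)ʲ`; every other hypothesis (two-leg rows keep the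
submultiplicative weight `(1+|x̃₀|+|x̃₁|)^·`), the conclusion and the proof are VERBATIM, the proof calling the `_pure` twin of the predecessor door.
WHY (KL STATUS 2026-08-28, p2 g22 «(B)-MAIN-UNPRIMED»): with the `(1+…)ʲ` weight the MAIN group of the general-step (B) door is `O(U²)` at every order
(the k-independent tadpole response of the bare vertex is charged in full) and its derivative rows cannot be booked against the unprimed curve-jet table
`klC4aJetC2`; with the pure weight the natural law of `N_j` is `O(U²)·(Λ_m⁻¹)ʲ` for `j ≥ 1`, so those rows are `O(U³)`.

* **`norm_iteratedFDeriv_klLocSelfEnergyRe_flowFrame_sub_le_aliasing_pure`**.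

Composition only; no definitions; nothing about the sizes is asserted; nothing asserts superconductivity.  References: BGM 2006 §2.3 (2.21)–(2.24), §3 (3.3)
[cite: BenfattoGiulianiMastropietro2006]; Salmhofer 1999 §4.2.5; FST 1996 §1.
-/

noncomputable section

namespace Summit.HubbardSuperconductivity.HubbardSuperconductivity.Theorems.EngineV8

set_option linter.dupNamespace false -- summit = problem name (single-conjunct summit), D-0017

open Finset Filter Literature.MathematicalPhysics.QuantumLattice Literature.Probability.LatticeModels GrassmannAlgebra
open Summit.HubbardSuperconductivity.HubbardSuperconductivity.Theorems.KLRegimeSplit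
open Summit.HubbardSuperconductivity.HubbardSuperconductivity.Theorems.TwoVolumeDefect
open Summit.HubbardSuperconductivity.HubbardSuperconductivity.Theorems.KLProgrammeLegKernels
open Summit.HubbardSuperconductivity.HubbardSuperconductivity.Theorems.DispersionFlow

variable {L M : ℕ} [NeZero L] [NeZero M]

section Flow

variable {β : ℝ} (hβ : 0 < β) (U μ : ℝ) (m : ℕ)
include hβ

/-- **THE CORRECTED (B) DOOR AT THE FLOW FRAMES WITH THE TREE AND DRESSING JETS DISCHARGED** (sup/aliasing route): at a reading point `q` below both
scale-`m` shells (`ω₀² + e_{K_{m+1}}(q)² < Λ_m²/4`, `ω₀² + e_{K_m}(q)² < Λ_m²/4` — all of `γ_{K_{m+1}}` when `m ≤ nScales β − 1`), the door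
`norm_iteratedFDeriv_klLocSelfEnergyRe_flowFrame_sub_le` holds with `A = A′ = A_tree` and `A_J` the dressed aliasing bounds: `tiny(L)` — polynomial in `L` times
`(2/N)^{Md−j−4}` resp. `(1+L/4)^{−s}` — given the two-leg `(1+|x̃|)`-moments `S_j, S_s` of `𝒲_t` and `S_j′, S_s′` of `Σ[𝒲′[Ψ̃]]` at the strings and the six sup-table
numbers `D_d, A_d, D_a, A_a, D_b, A_b` of the dressing symbols (supplied by `…EngineFrameShiftDressingFactorTables`). [cite: BenfattoGiulianiMastropietro2006, §2.3 (2.21)–(2.24)] -/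
theorem norm_iteratedFDeriv_klLocSelfEnergyRe_flowFrame_sub_le_aliasing_pure
    {R : RenConsts} {Nf₁ Nf₂ : ℕ} (hOK₁ : FrameOK R U Nf₁ μ (klFlowFrameU L M β U μ m)) (hOK₂ : FrameOK R U Nf₂ μ (klFlowFrameU L M β U μ (m + 1)))
    {B₁ : ℝ} (hB0 : 0 ≤ B₁) (hB : ∀ y, |deriv salmhoferCutoff y| ≤ B₁)
    {fd : ℝ} (hfdist : frameDist (klFlowFrameU L M β U μ (m + 1)) (klFlowFrameU L M β U μ m) ≤ fd) (hfd : fd ≤ (klScale klE0 m) / 4)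
    (hZ₂ : IsUnit (effPartitionFn ℂ (normalCovariance L M (uvSymbolCT L M β μ (klFlowFrameU L M β U μ (m + 1)) (klScale klE0 m))) (hubbardInteraction L M β U + counterQuadratic L M β (klFlowFrameU L M β U μ (m + 1)))))
    (hZ : ∀ t ∈ Set.Icc (0 : ℝ) 1, effPartitionFn ℂ
      (normalCovariance L M (uvSymbolCT L M β μ (klFlowFrameU L M β U μ m) (klScale klE0 m)) + ((t : ℂ)) • (normalCovariance L M (fun ks => uvSymbolCT L M β μ (klFlowFrameU L M β U μ (m + 1)) (klScale klE0 m) ks / (1 + uvSymbolCT L M β μ (klFlowFrameU L M β U μ (m + 1)) (klScale klE0 m) ks * (((fsub (klFlowFrameU L M β U μ (m + 1)) (klFlowFrameU L M β U μ m)).eval (latticeMomentum L ks.1.2) / (β * (L : ℝ) ^ 2) : ℝ) : ℂ))) - normalCovariance L M (uvSymbolCT L M β μ (klFlowFrameU L M β U μ m) (klScale klE0 m)))) (hubbardInteraction L M β U + counterQuadratic L M β (klFlowFrameU L M β U μ m)) ≠ 0)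
    (j : ℕ) (q : Momentum) {N : ℝ} (hN0 : 0 ≤ N)
    (hN : ∀ t ∈ Set.Icc (0 : ℝ) 1, ∀ i ∈ ({omega0 M, (omega0 M).rev} : Finset (MatsubaraIdx M)), ∀ σ : Fin 2, ∀ Al : HubbardFieldIdx L M,
      |matsubaraFreq β M Al.1.1.1| < (klScale klE0 m) →
      (|nambuXiCT L μ (klFlowFrameU L M β U μ m) Al.1.1.2| < (klScale klE0 m) ∨ |nambuXiCT L μ (klFlowFrameU L M β U μ (m + 1)) Al.1.1.2| < (klScale klE0 m)) →
      ∑ x : TorusSite 2 L, (((x 0).valMinAbs.natAbs : ℝ) + ((x 1).valMinAbs.natAbs : ℝ)) ^ j * ‖torusFourierInv (fun kv : TorusSite 2 L =>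
        kernel ℂ (effAction ℂ (normalCovariance L M (uvSymbolCT L M β μ (klFlowFrameU L M β U μ m) (klScale klE0 m)) + ((t : ℂ)) • (normalCovariance L M (fun ks => uvSymbolCT L M β μ (klFlowFrameU L M β U μ (m + 1)) (klScale klE0 m) ks / (1 + uvSymbolCT L M β μ (klFlowFrameU L M β U μ (m + 1)) (klScale klE0 m) ks * (((fsub (klFlowFrameU L M β U μ (m + 1)) (klFlowFrameU L M β U μ m)).eval (latticeMomentum L ks.1.2) / (β * (L : ℝ) ^ 2) : ℝ) : ℂ))) - normalCovariance L M (uvSymbolCT L M β μ (klFlowFrameU L M β U μ m) (klScale klE0 m)))) (hubbardInteraction L M β U + counterQuadratic L M β (klFlowFrameU L M β U μ m))) 4 (Fin.snoc (Fin.snoc ![((((i, kv), σ), 0) : HubbardFieldIdx L M), (((i, kv), σ), 1)] (Al.1, 1 - Al.2) : Fin 3 → HubbardFieldIdx L M) Al)) x‖ ≤ N)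
    -- the reading point is below both shells
    (hq₂ : (Real.pi / β) ^ 2 + frameLevel μ (klFlowFrameU L M β U μ (m + 1)) q ^ 2 < (klScale klE0 m) ^ 2 / 4) (hq₁ : (Real.pi / β) ^ 2 + frameLevel μ (klFlowFrameU L M β U μ m) q ^ 2 < (klScale klE0 m) ^ 2 / 4)
    -- two-leg moments of `𝒲_t` and of `Σ[𝒲′[Ψ̃]]` at the strings
    {Md s : ℕ} (hM : 4 + j ≤ Md) {Sj Ss Sj' Ss' : ℝ}
    (hRmom : ∀ t ∈ Set.Icc (0 : ℝ) 1, ∀ i ∈ ({omega0 M, (omega0 M).rev} : Finset (MatsubaraIdx M)), ∀ σ : Fin 2,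
      (∑ x : TorusSite 2 L, (1 + ((x 0).valMinAbs.natAbs : ℝ) + ((x 1).valMinAbs.natAbs : ℝ)) ^ j * ‖torusFourierInv (fun kv : TorusSite 2 L =>
        kernel ℂ (effAction ℂ (normalCovariance L M (uvSymbolCT L M β μ (klFlowFrameU L M β U μ m) (klScale klE0 m)) + ((t : ℂ)) • (normalCovariance L M (fun ks => uvSymbolCT L M β μ (klFlowFrameU L M β U μ (m + 1)) (klScale klE0 m) ks / (1 + uvSymbolCT L M β μ (klFlowFrameU L M β U μ (m + 1)) (klScale klE0 m) ks * (((fsub (klFlowFrameU L M β U μ (m + 1)) (klFlowFrameU L M β U μ m)).eval (latticeMomentum L ks.1.2) / (β * (L : ℝ) ^ 2) : ℝ) : ℂ))) - normalCovariance L M (uvSymbolCT L M β μ (klFlowFrameU L M β U μ m) (klScale klE0 m)))) (hubbardInteraction L M β U + counterQuadratic L M β (klFlowFrameU L M β U μ m))) 2 ![((((i, kv), σ), 0) : HubbardFieldIdx L M), (((i, kv), σ), 1)]) x‖ ≤ Sj) ∧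
      (∑ x : TorusSite 2 L, (1 + ((x 0).valMinAbs.natAbs : ℝ) + ((x 1).valMinAbs.natAbs : ℝ)) ^ s * ‖torusFourierInv (fun kv : TorusSite 2 L =>
        kernel ℂ (effAction ℂ (normalCovariance L M (uvSymbolCT L M β μ (klFlowFrameU L M β U μ m) (klScale klE0 m)) + ((t : ℂ)) • (normalCovariance L M (fun ks => uvSymbolCT L M β μ (klFlowFrameU L M β U μ (m + 1)) (klScale klE0 m) ks / (1 + uvSymbolCT L M β μ (klFlowFrameU L M β U μ (m + 1)) (klScale klE0 m) ks * (((fsub (klFlowFrameU L M β U μ (m + 1)) (klFlowFrameU L M β U μ m)).eval (latticeMomentum L ks.1.2) / (β * (L : ℝ) ^ 2) : ℝ) : ℂ))) - normalCovariance L M (uvSymbolCT L M β μ (klFlowFrameU L M β U μ m) (klScale klE0 m)))) (hubbardInteraction L M β U + counterQuadratic L M β (klFlowFrameU L M β U μ m))) 2 ![((((i, kv), σ), 0) : HubbardFieldIdx L M), (((i, kv), σ), 1)]) x‖ ≤ Ss))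
    (hSE : ∀ i ∈ ({omega0 M, (omega0 M).rev} : Finset (MatsubaraIdx M)), ∀ σ : Fin 2,
      (∑ x : TorusSite 2 L, (1 + ((x 0).valMinAbs.natAbs : ℝ) + ((x 1).valMinAbs.natAbs : ℝ)) ^ j * ‖torusFourierInv (fun kv : TorusSite 2 L =>
        selfEnergy L M β (effAction ℂ (normalCovariance L M (fun ks => uvSymbolCT L M β μ (klFlowFrameU L M β U μ (m + 1)) (klScale klE0 m) ks / (1 + uvSymbolCT L M β μ (klFlowFrameU L M β U μ (m + 1)) (klScale klE0 m) ks * (((fsub (klFlowFrameU L M β U μ (m + 1)) (klFlowFrameU L M β U μ m)).eval (latticeMomentum L ks.1.2) / (β * (L : ℝ) ^ 2) : ℝ) : ℂ)))) (hubbardInteraction L M β U + counterQuadratic L M β (klFlowFrameU L M β U μ m))) (i, kv) σ) x‖ ≤ Sj') ∧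
      (∑ x : TorusSite 2 L, (1 + ((x 0).valMinAbs.natAbs : ℝ) + ((x 1).valMinAbs.natAbs : ℝ)) ^ s * ‖torusFourierInv (fun kv : TorusSite 2 L =>
        selfEnergy L M β (effAction ℂ (normalCovariance L M (fun ks => uvSymbolCT L M β μ (klFlowFrameU L M β U μ (m + 1)) (klScale klE0 m) ks / (1 + uvSymbolCT L M β μ (klFlowFrameU L M β U μ (m + 1)) (klScale klE0 m) ks * (((fsub (klFlowFrameU L M β U μ (m + 1)) (klFlowFrameU L M β U μ m)).eval (latticeMomentum L ks.1.2) / (β * (L : ℝ) ^ 2) : ℝ) : ℂ)))) (hubbardInteraction L M β U + counterQuadratic L M β (klFlowFrameU L M β U μ m))) (i, kv) σ) x‖ ≤ Ss'))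
    -- the six sup-table numbers of the dressing symbols (`…EngineFrameShiftDressingFactorTables`)
    {Dd Ad Da Aa Db Ab : ℝ}
    (hDd : ∀ i ∈ ({omega0 M, (omega0 M).rev} : Finset (MatsubaraIdx M)), ∀ q' : Momentum, ‖iteratedFDeriv ℝ Md (fun q : Momentum => ((((uvWeightFn (klScale klE0 m) (matsubaraFreq β M i) (frameLevel μ (klFlowFrameU L M β U μ (m + 1)) q) : ℝ) : ℂ) * resolventFnXi (β * (L : ℝ) ^ 2) 0 (matsubaraFreq β M i) (frameLevel μ (klFlowFrameU L M β U μ (m + 1)) q + uvWeightFn (klScale klE0 m) (matsubaraFreq β M i) (frameLevel μ (klFlowFrameU L M β U μ (m + 1)) q) * evalM (fsub (klFlowFrameU L M β U μ (m + 1)) (klFlowFrameU L M β U μ m)) q)) - uvSymbolFnXi (β * (L : ℝ) ^ 2) (klScale klE0 m) (matsubaraFreq β M i) (frameLevel μ (klFlowFrameU L M β U μ (m + 1)) q + evalM (fsub (klFlowFrameU L M β U μ (m + 1)) (klFlowFrameU L M β U μ m)) q))) q'‖ ≤ Dd)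
    (hAd : ∀ i ∈ ({omega0 M, (omega0 M).rev} : Finset (MatsubaraIdx M)), ∀ q' : Momentum, ‖(fun q : Momentum => ((((uvWeightFn (klScale klE0 m) (matsubaraFreq β M i) (frameLevel μ (klFlowFrameU L M β U μ (m + 1)) q) : ℝ) : ℂ) * resolventFnXi (β * (L : ℝ) ^ 2) 0 (matsubaraFreq β M i) (frameLevel μ (klFlowFrameU L M β U μ (m + 1)) q + uvWeightFn (klScale klE0 m) (matsubaraFreq β M i) (frameLevel μ (klFlowFrameU L M β U μ (m + 1)) q) * evalM (fsub (klFlowFrameU L M β U μ (m + 1)) (klFlowFrameU L M β U μ m)) q)) - uvSymbolFnXi (β * (L : ℝ) ^ 2) (klScale klE0 m) (matsubaraFreq β M i) (frameLevel μ (klFlowFrameU L M β U μ (m + 1)) q + evalM (fsub (klFlowFrameU L M β U μ (m + 1)) (klFlowFrameU L M β U μ m)) q))) q'‖ ≤ Ad)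
    (hDa : ∀ i ∈ ({omega0 M, (omega0 M).rev} : Finset (MatsubaraIdx M)), ∀ q' : Momentum, ‖iteratedFDeriv ℝ Md (fun q : Momentum => (-((((evalM (fsub (klFlowFrameU L M β U μ (m + 1)) (klFlowFrameU L M β U μ m)) q * evalM (fsub (klFlowFrameU L M β U μ (m + 1)) (klFlowFrameU L M β U μ m)) q) / (β * (L : ℝ) ^ 2) : ℝ)) : ℂ) * (((uvWeightFn (klScale klE0 m) (matsubaraFreq β M i) (frameLevel μ (klFlowFrameU L M β U μ (m + 1)) q) : ℝ) : ℂ) * resolventFnXi (β * (L : ℝ) ^ 2) 0 (matsubaraFreq β M i) (frameLevel μ (klFlowFrameU L M β U μ (m + 1)) q + uvWeightFn (klScale klE0 m) (matsubaraFreq β M i) (frameLevel μ (klFlowFrameU L M β U μ (m + 1)) q) * evalM (fsub (klFlowFrameU L M β U μ (m + 1)) (klFlowFrameU L M β U μ m)) q)))) q'‖ ≤ Da)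
    (hAa : ∀ i ∈ ({omega0 M, (omega0 M).rev} : Finset (MatsubaraIdx M)), ∀ q' : Momentum, ‖(fun q : Momentum => (-((((evalM (fsub (klFlowFrameU L M β U μ (m + 1)) (klFlowFrameU L M β U μ m)) q * evalM (fsub (klFlowFrameU L M β U μ (m + 1)) (klFlowFrameU L M β U μ m)) q) / (β * (L : ℝ) ^ 2) : ℝ)) : ℂ) * (((uvWeightFn (klScale klE0 m) (matsubaraFreq β M i) (frameLevel μ (klFlowFrameU L M β U μ (m + 1)) q) : ℝ) : ℂ) * resolventFnXi (β * (L : ℝ) ^ 2) 0 (matsubaraFreq β M i) (frameLevel μ (klFlowFrameU L M β U μ (m + 1)) q + uvWeightFn (klScale klE0 m) (matsubaraFreq β M i) (frameLevel μ (klFlowFrameU L M β U μ (m + 1)) q) * evalM (fsub (klFlowFrameU L M β U μ (m + 1)) (klFlowFrameU L M β U μ m)) q)))) q'‖ ≤ Aa)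
    (hDb : ∀ i ∈ ({omega0 M, (omega0 M).rev} : Finset (MatsubaraIdx M)), ∀ q' : Momentum, ‖iteratedFDeriv ℝ Md (fun q : Momentum => (((((evalM (fsub (klFlowFrameU L M β U μ (m + 1)) (klFlowFrameU L M β U μ m)) q / (β * (L : ℝ) ^ 2) : ℝ)) : ℂ) * (((uvWeightFn (klScale klE0 m) (matsubaraFreq β M i) (frameLevel μ (klFlowFrameU L M β U μ (m + 1)) q) : ℝ) : ℂ) * resolventFnXi (β * (L : ℝ) ^ 2) 0 (matsubaraFreq β M i) (frameLevel μ (klFlowFrameU L M β U μ (m + 1)) q + uvWeightFn (klScale klE0 m) (matsubaraFreq β M i) (frameLevel μ (klFlowFrameU L M β U μ (m + 1)) q) * evalM (fsub (klFlowFrameU L M β U μ (m + 1)) (klFlowFrameU L M β U μ m)) q))) * ((((evalM (fsub (klFlowFrameU L M β U μ (m + 1)) (klFlowFrameU L M β U μ m)) q / (β * (L : ℝ) ^ 2) : ℝ)) : ℂ) * (((uvWeightFn (klScale klE0 m) (matsubaraFreq β M i) (frameLevel μ (klFlowFrameU L M β U μ (m + 1)) q) : ℝ) : ℂ) * resolventFnXi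 (β * (L : ℝ) ^ 2) 0 (matsubaraFreq β M i) (frameLevel μ (klFlowFrameU L M β U μ (m + 1)) q + uvWeightFn (klScale klE0 m) (matsubaraFreq β M i) (frameLevel μ (klFlowFrameU L M β U μ (m + 1)) q) * evalM (fsub (klFlowFrameU L M β U μ (m + 1)) (klFlowFrameU L M β U μ m)) q))) - (2 : ℂ) * ((((evalM (fsub (klFlowFrameU L M β U μ (m + 1)) (klFlowFrameU L M β U μ m)) q / (β * (L : ℝ) ^ 2) : ℝ)) : ℂ) * (((uvWeightFn (klScale klE0 m) (matsubaraFreq β M i) (frameLevel μ (klFlowFrameU L M β U μ (m + 1)) q) : ℝ) : ℂ) * resolventFnXi (β * (L : ℝ) ^ 2) 0 (matsubaraFreq β M i) (frameLevel μ (klFlowFrameU L M β U μ (m + 1)) q + uvWeightFn (klScale klE0 m) (matsubaraFreq β M i) (frameLevel μ (klFlowFrameU L M β U μ (m + 1)) q) * evalM (fsub (klFlowFrameU L M β U μ (m + 1)) (klFlowFrameU L M β U μ m)) q))))) q'‖ ≤ Db)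
    (hAb : ∀ i ∈ ({omega0 M, (omega0 M).rev} : Finset (MatsubaraIdx M)), ∀ q' : Momentum, ‖(fun q : Momentum => (((((evalM (fsub (klFlowFrameU L M β U μ (m + 1)) (klFlowFrameU L M β U μ m)) q / (β * (L : ℝ) ^ 2) : ℝ)) : ℂ) * (((uvWeightFn (klScale klE0 m) (matsubaraFreq β M i) (frameLevel μ (klFlowFrameU L M β U μ (m + 1)) q) : ℝ) : ℂ) * resolventFnXi (β * (L : ℝ) ^ 2) 0 (matsubaraFreq β M i) (frameLevel μ (klFlowFrameU L M β U μ (m + 1)) q + uvWeightFn (klScale klE0 m) (matsubaraFreq β M i) (frameLevel μ (klFlowFrameU L M β U μ (m + 1)) q) * evalM (fsub (klFlowFrameU L M β U μ (m + 1)) (klFlowFrameU L M β U μ m)) q))) * ((((evalM (fsub (klFlowFrameU L M β U μ (m + 1)) (klFlowFrameU L M β U μ m)) q / (β * (L : ℝ) ^ 2) : ℝ)) : ℂ) * (((uvWeightFn (klScale klE0 m) (matsubaraFreq β M i) (frameLevel μ (klFlowFrameU L M β U μ (m + 1)) q) : ℝ) : ℂ) * resolventFnXi (β * (L : ℝ)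 ^ 2) 0 (matsubaraFreq β M i) (frameLevel μ (klFlowFrameU L M β U μ (m + 1)) q + uvWeightFn (klScale klE0 m) (matsubaraFreq β M i) (frameLevel μ (klFlowFrameU L M β U μ (m + 1)) q) * evalM (fsub (klFlowFrameU L M β U μ (m + 1)) (klFlowFrameU L M β U μ m)) q))) - (2 : ℂ) * ((((evalM (fsub (klFlowFrameU L M β U μ (m + 1)) (klFlowFrameU L M β U μ m)) q / (β * (L : ℝ) ^ 2) : ℝ)) : ℂ) * (((uvWeightFn (klScale klE0 m) (matsubaraFreq β M i) (frameLevel μ (klFlowFrameU L M β U μ (m + 1)) q) : ℝ) : ℂ) * resolventFnXi (β * (L : ℝ) ^ 2) 0 (matsubaraFreq β M i) (frameLevel μ (klFlowFrameU L M β U μ (m + 1)) q + uvWeightFn (klScale klE0 m) (matsubaraFreq β M i) (frameLevel μ (klFlowFrameU L M β U μ (m + 1)) q) * evalM (fsub (klFlowFrameU L M β U μ (m + 1)) (klFlowFrameU L M β U μ m)) q))))) q'‖ ≤ Ab) :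
    ‖iteratedFDeriv ℝ j (evalM (symInterp L (fun kv : TorusSite 2 L =>
        klLocSelfEnergyRe L M β U μ (klFlowFrameU L M β U μ (m + 1)) m kv - klLocSelfEnergyRe L M β U μ (klFlowFrameU L M β U μ m) m kv - (fsub (klFlowFrameU L M β U μ (m + 1)) (klFlowFrameU L M β U μ m)).eval (latticeMomentum L kv)))) q‖ ≤
      2 * (2 * (|β| * (L : ℝ) ^ 2) * (12 * (2 * ((klScale klE0 m) * β / Real.pi + 3) *
        ((1793 * (klScale klE0 m) * (L : ℝ) ^ 2 + 704 * L) + (1793 * (klScale klE0 m) * (L : ℝ) ^ 2 + 704 * L)) *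
        (β * (L : ℝ) ^ 2 * (200 + 200 * B₁) / (klScale klE0 m) ^ 2 * fd)) * N)) +
      ((4 * (2 * (2 * ((2 * |β| * (L : ℝ) ^ 2 * Sj ^ 2) * ((3 : ℝ) ^ j * Dd * (2 / ((2 * (L / 4 + 1) : ℕ) : ℝ)) ^ (Md - j - 4) * (2 ^ 2 * ∑' k : Fin 2 → ℤ, ∏ c, (1 + (k c : ℝ) ^ 2)⁻¹)))) + (L : ℝ) ^ 2 * (L : ℝ) ^ j * (Ad * ((2 * |β| * (L : ℝ) ^ 2 * Ss ^ 2) / (1 + (L : ℝ) / 4) ^ s)))) + (4 * (2 * (2 * ((2 * |β| * (L : ℝ) ^ 2 * Sj ^ 2) * ((3 : ℝ) ^ j * Dd * (2 / ((2 * (L / 4 + 1) : ℕ) : ℝ)) ^ (Md - j - 4) * (2 ^ 2 * ∑' k : Fin 2 → ℤ, ∏ c, (1 + (k c : ℝ) ^ 2)⁻¹)))) + (L : ℝ) ^ 2 * (L : ℝ) ^ j * (Ad * ((2 * |β| * (L : ℝ) ^ 2 * Ss ^ 2) / (1 + (L : ℝ) / 4) ^ s))))) / 2 + (2 * (2 :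 ℕ) * ((2 * (2 * ((1 / 4 : ℝ) * ((3 : ℝ) ^ j * Da * (2 / ((2 * (L / 4 + 1) : ℕ) : ℝ)) ^ (Md - j - 4) * (2 ^ 2 * ∑' k : Fin 2 → ℤ, ∏ c, (1 + (k c : ℝ) ^ 2)⁻¹)))) + (L : ℝ) ^ 2 * (L : ℝ) ^ j * (Aa * ((1 / 4 : ℝ) / (1 + (L : ℝ) / 4) ^ s))) + (2 * (2 * ((1 / 4 * Sj') * ((3 : ℝ) ^ j * Db * (2 / ((2 * (L / 4 + 1) : ℕ) : ℝ)) ^ (Md - j - 4) * (2 ^ 2 * ∑' k : Fin 2 → ℤ, ∏ c, (1 + (k c : ℝ) ^ 2)⁻¹)))) + (L : ℝ) ^ 2 * (L : ℝ) ^ j * (Ab * ((1 / 4 * Ss') / (1 + (L : ℝ) / 4) ^ s))))) := by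
  have hL : (0 : ℝ) < L := by exact_mod_cast NeZero.pos L
  have hΛ : 0 < (klScale klE0 m) := by unfold klScale klE0; positivity
  have hI : ∀ i ∈ ({omega0 M, (omega0 M).rev} : Finset (MatsubaraIdx M)), (matsubaraFreq β M i) ^ 2 = (Real.pi / β) ^ 2 := by
    intro i hi
    rcases Finset.mem_insert.1 hi with h | h
    · rw [h, matsubaraFreq_omega0]
    · rw [Finset.mem_singleton.1 h, matsubaraFreq_omega0_rev, neg_sq]
  have hω : ∀ i : MatsubaraIdx M, (matsubaraFreq β M i) ≠ 0 := fun i => matsubaraFreq_ne_zero hβ.ne' i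
  -- their invariances (periodicity, reflection, swap) from the band pair
  have hginv := fun i : MatsubaraIdx M => bandPair_comp_invariant μ (klFlowFrameU L M β U μ m) (klFlowFrameU L M β U μ (m + 1))
    (fun u v => (((uvWeightFn (klScale klE0 m) (matsubaraFreq β M i) u : ℝ) : ℂ) * resolventFnXi (β * (L : ℝ) ^ 2) 0 (matsubaraFreq β M i) (u + uvWeightFn (klScale klE0 m) (matsubaraFreq β M i) u * v)) -
      uvSymbolFnXi (β * (L : ℝ) ^ 2) (klScale klE0 m) (matsubaraFreq β M i) (u + v))
  have hainv := fun i : MatsubaraIdx M => bandPair_comp_invariant μ (klFlowFrameU L M β U μ m) (klFlowFrameU L M β U μ (m + 1))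
    (fun u v => -((((v * v) / (β * (L : ℝ) ^ 2) : ℝ)) : ℂ) * (((uvWeightFn (klScale klE0 m) (matsubaraFreq β M i) u : ℝ) : ℂ) * resolventFnXi (β * (L : ℝ) ^ 2) 0 (matsubaraFreq β M i) (u + uvWeightFn (klScale klE0 m) (matsubaraFreq β M i) u * v)))
  have hbinv := fun i : MatsubaraIdx M => bandPair_comp_invariant μ (klFlowFrameU L M β U μ m) (klFlowFrameU L M β U μ (m + 1))
    (fun u v => ((((v / (β * (L : ℝ) ^ 2) : ℝ)) : ℂ) * (((uvWeightFn (klScale klE0 m) (matsubaraFreq β M i) u : ℝ) : ℂ) * resolventFnXi (β * (L : ℝ) ^ 2) 0 (matsubaraFreq β M i) (u + uvWeightFn (klScale klE0 m) (matsubaraFreq β M i) u * v))) *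
      ((((v / (β * (L : ℝ) ^ 2) : ℝ)) : ℂ) * (((uvWeightFn (klScale klE0 m) (matsubaraFreq β M i) u : ℝ) : ℂ) * resolventFnXi (β * (L : ℝ) ^ 2) 0 (matsubaraFreq β M i) (u + uvWeightFn (klScale klE0 m) (matsubaraFreq β M i) u * v))) -
      (2 : ℂ) * ((((v / (β * (L : ℝ) ^ 2) : ℝ)) : ℂ) * (((uvWeightFn (klScale klE0 m) (matsubaraFreq β M i) u : ℝ) : ℂ) * resolventFnXi (β * (L : ℝ) ^ 2) 0 (matsubaraFreq β M i) (u + uvWeightFn (klScale klE0 m) (matsubaraFreq β M i) u * v))))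
  -- the TREE jets
  have hT := norm_iteratedFDeriv_symInterp_treeData_le (uvSymbolCT L M β μ (klFlowFrameU L M β U μ m) (klScale klE0 m)) (fun ks => uvSymbolCT L M β μ (klFlowFrameU L M β U μ (m + 1)) (klScale klE0 m) ks / (1 + uvSymbolCT L M β μ (klFlowFrameU L M β U μ (m + 1)) (klScale klE0 m) ks * (((fsub (klFlowFrameU L M β U μ (m + 1)) (klFlowFrameU L M β U μ m)).eval (latticeMomentum L ks.1.2) / (β * (L : ℝ) ^ 2) : ℝ) : ℂ))) β U (klFlowFrameU L M β U μ m) (omega0 M) (omega0 M).rev (g := fun i q => ((((uvWeightFn (klScale klE0 m) (matsubaraFreq β M i) (frameLevel μ (klFlowFrameU L M β U μ (m + 1)) q) : ℝ) : ℂ) * resolventFnXi (β * (L : ℝ) ^ 2) 0 (matsubaraFreq β M i) (frameLevel μ (klFlowFrameU L M β U μ (m + 1)) q + uvWeightFn (klScale klE0 m) (matsubaraFreq β M i) (frameLevel μ (klFlowFrameU L M β U μ (m + 1)) q) * evalM (fsub (klFlowFrameU L M β U μ (m + 1)) (klFlowFrameU L M β U μ m)) q)) - uvSymbolFnXi (β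 * (L : ℝ) ^ 2) (klScale klE0 m) (matsubaraFreq β M i) (frameLevel μ (klFlowFrameU L M β U μ (m + 1)) q + evalM (fsub (klFlowFrameU L M β U μ (m + 1)) (klFlowFrameU L M β U μ m)) q)))
    (fun i _ kv σ => mismatchDefect_eq_sample hβ μ (klFlowFrameU L M β U μ m) (klFlowFrameU L M β U μ (m + 1)) (klScale klE0 m) i kv σ)
    (fun i _ => (hginv i).1) (fun i _ => contDiff_defectSymbol μ (klFlowFrameU L M β U μ m) (klFlowFrameU L M β U μ (m + 1)) (β * (L : ℝ) ^ 2) (klScale klE0 m) (matsubaraFreq β M i) (hω i))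
    (fun i _ => (hginv i).2.1) (fun i _ => (hginv i).2.2) hM hDd hAd
    (fun i hi => defect_eventually_zero μ (klFlowFrameU L M β U μ m) (klFlowFrameU L M β U μ (m + 1)) (β * (L : ℝ) ^ 2) hΛ (matsubaraFreq β M i) (by rw [hI i hi]; exact hq₂) (by rw [hI i hi]; exact hq₁)) hRmom
  -- the DRESSING jets
  have hJ := norm_iteratedFDeriv_symInterp_dressingData_le ({omega0 M, (omega0 M).rev} : Finset (MatsubaraIdx M))
    (fun i kv σ => -((((β * (L : ℝ) ^ 2) : ℝ) : ℂ) * ((((fsub (klFlowFrameU L M β U μ (m + 1)) (klFlowFrameU L M β U μ m)).eval (latticeMomentum L kv) / (β * (L : ℝ) ^ 2) : ℝ) : ℂ)) ^ 2 * (uvSymbolCT L M β μ (klFlowFrameU L M β U μ (m + 1)) (klScale klE0 m) ((i, kv), σ) / (1 + uvSymbolCT L M β μ (klFlowFrameU L M β U μ (m + 1)) (klScale klE0 m) ((i, kv), σ) * (((fsub (klFlowFrameU L M β U μ (m + 1)) (klFlowFrameU L M β U μ m)).eval (latticeMomentum L kv) / (β * (L : ℝ) ^ 2) : ℝ) : 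ℂ)))))
    (fun i kv σ => (1 - ((((fsub (klFlowFrameU L M β U μ (m + 1)) (klFlowFrameU L M β U μ m)).eval (latticeMomentum L kv) / (β * (L : ℝ) ^ 2) : ℝ) : ℂ)) * (uvSymbolCT L M β μ (klFlowFrameU L M β U μ (m + 1)) (klScale klE0 m) ((i, kv), σ) / (1 + uvSymbolCT L M β μ (klFlowFrameU L M β U μ (m + 1)) (klScale klE0 m) ((i, kv), σ) * (((fsub (klFlowFrameU L M β U μ (m + 1)) (klFlowFrameU L M β U μ m)).eval (latticeMomentum L kv) / (β * (L : ℝ) ^ 2) : ℝ) : ℂ)))) ^ 2 - 1)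
    (fun p σ => selfEnergy L M β (effAction ℂ (normalCovariance L M (fun ks => uvSymbolCT L M β μ (klFlowFrameU L M β U μ (m + 1)) (klScale klE0 m) ks / (1 + uvSymbolCT L M β μ (klFlowFrameU L M β U μ (m + 1)) (klScale klE0 m) ks * (((fsub (klFlowFrameU L M β U μ (m + 1)) (klFlowFrameU L M β U μ m)).eval (latticeMomentum L ks.1.2) / (β * (L : ℝ) ^ 2) : ℝ) : ℂ)))) (hubbardInteraction L M β U + counterQuadratic L M β (klFlowFrameU L M β U μ m))) p σ) (a := fun i q => (-((((evalM (fsub (klFlowFrameU L M β U μ (m + 1)) (klFlowFrameU L M β U μ m)) q * evalM (fsub (klFlowFrameU L M β U μ (m + 1)) (klFlowFrameU L M β U μ m)) q) / (β * (L : ℝ) ^ 2) : ℝ)) : ℂ) * (((uvWeightFn (klScale klE0 m) (matsubaraFreq β M i) (frameLevel μ (klFlowFrameU L M β U μ (m + 1)) q) : ℝ) : ℂ) * resolventFnXi (β * (L : ℝ) ^ 2) 0 (matsubaraFreq β M i) (frameLevel μ (klFlowFrameU L M β U μ (m + 1)) q + uvWeightFn (klScale klE0 m) (matsubaraFreq β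 M i) (frameLevel μ (klFlowFrameU L M β U μ (m + 1)) q) * evalM (fsub (klFlowFrameU L M β U μ (m + 1)) (klFlowFrameU L M β U μ m)) q)))) (b := fun i q => (((((evalM (fsub (klFlowFrameU L M β U μ (m + 1)) (klFlowFrameU L M β U μ m)) q / (β * (L : ℝ) ^ 2) : ℝ)) : ℂ) * (((uvWeightFn (klScale klE0 m) (matsubaraFreq β M i) (frameLevel μ (klFlowFrameU L M β U μ (m + 1)) q) : ℝ) : ℂ) * resolventFnXi (β * (L : ℝ) ^ 2) 0 (matsubaraFreq β M i) (frameLevel μ (klFlowFrameU L M β U μ (m + 1)) q + uvWeightFn (klScale klE0 m) (matsubaraFreq β M i) (frameLevel μ (klFlowFrameU L M β U μ (m + 1)) q) * evalM (fsub (klFlowFrameU L M β U μ (m + 1)) (klFlowFrameU L M β U μ m)) q))) * ((((evalM (fsub (klFlowFrameU L M β U μ (m + 1)) (klFlowFrameU L M β U μ m)) q / (β * (L : ℝ) ^ 2) : ℝ)) : ℂ) * (((uvWeightFn (klScale klE0 m) (matsubaraFreq β M i) (frameLevel μ (klFlowFrameU L M β U μ (m + 1)) q) : ℝ) : ℂ)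 * resolventFnXi (β * (L : ℝ) ^ 2) 0 (matsubaraFreq β M i) (frameLevel μ (klFlowFrameU L M β U μ (m + 1)) q + uvWeightFn (klScale klE0 m) (matsubaraFreq β M i) (frameLevel μ (klFlowFrameU L M β U μ (m + 1)) q) * evalM (fsub (klFlowFrameU L M β U μ (m + 1)) (klFlowFrameU L M β U μ m)) q))) - (2 : ℂ) * ((((evalM (fsub (klFlowFrameU L M β U μ (m + 1)) (klFlowFrameU L M β U μ m)) q / (β * (L : ℝ) ^ 2) : ℝ)) : ℂ) * (((uvWeightFn (klScale klE0 m) (matsubaraFreq β M i) (frameLevel μ (klFlowFrameU L M β U μ (m + 1)) q) : ℝ) : ℂ) * resolventFnXi (β * (L : ℝ) ^ 2) 0 (matsubaraFreq β M i) (frameLevel μ (klFlowFrameU L M β U μ (m + 1)) q + uvWeightFn (klScale klE0 m) (matsubaraFreq β M i) (frameLevel μ (klFlowFrameU L M β U μ (m + 1)) q) * evalM (fsub (klFlowFrameU L M β U μ (m + 1)) (klFlowFrameU L M β U μ m)) q)))))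
    (fun i _ kv σ => dressingJ₂_eq_sample hβ μ (klFlowFrameU L M β U μ m) (klFlowFrameU L M β U μ (m + 1)) (klScale klE0 m) i kv σ) (fun i _ kv σ => dressingJ₁_eq_sample hβ μ (klFlowFrameU L M β U μ m) (klFlowFrameU L M β U μ (m + 1)) (klScale klE0 m) i kv σ)
    (fun i _ => (hainv i).1) (fun i _ => (hbinv i).1)
    (fun i _ => contDiff_dressingJ₂Symbol μ (klFlowFrameU L M β U μ m) (klFlowFrameU L M β U μ (m + 1)) (β * (L : ℝ) ^ 2) (klScale klE0 m) (matsubaraFreq β M i) (hω i))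
    (fun i _ => contDiff_dressingJ₁Symbol μ (klFlowFrameU L M β U μ m) (klFlowFrameU L M β U μ (m + 1)) (β * (L : ℝ) ^ 2) (klScale klE0 m) (matsubaraFreq β M i) (hω i))
    (fun i _ => (hainv i).2.1) (fun i _ => (hainv i).2.2) (fun i _ => (hbinv i).2.1) (fun i _ => (hbinv i).2.2) hM hDa hDb hAa hAb
    (fun i hi => dressingJ₂_eventually_zero μ (klFlowFrameU L M β U μ m) (klFlowFrameU L M β U μ (m + 1)) (β * (L : ℝ) ^ 2) hΛ (matsubaraFreq β M i) (by rw [hI i hi]; exact hq₂))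
    (fun i hi => dressingJ₁_eventually_zero μ (klFlowFrameU L M β U μ m) (klFlowFrameU L M β U μ (m + 1)) (β * (L : ℝ) ^ 2) hΛ (matsubaraFreq β M i) (by rw [hI i hi]; exact hq₂)) hSE
  have hcard : ((({omega0 M, (omega0 M).rev} : Finset (MatsubaraIdx M))).card : ℝ) ≤ (2 : ℕ) := by exact_mod_cast Finset.card_le_two
  have hA0 : 0 ≤ (4 * (2 * (2 * ((2 * |β| * (L : ℝ) ^ 2 * Sj ^ 2) * ((3 : ℝ) ^ j * Dd * (2 / ((2 * (L / 4 + 1) : ℕ) : ℝ)) ^ (Md - j - 4) * (2 ^ 2 * ∑' k : Fin 2 → ℤ, ∏ c, (1 + (k c : ℝ) ^ 2)⁻¹)))) + (L : ℝ) ^ 2 * (L : ℝ) ^ j * (Ad * ((2 * |β| * (L : ℝ) ^ 2 * Ss ^ 2) / (1 + (L : ℝ) / 4) ^ s)))) := by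
    have h1 := (hT 0 ⟨le_rfl, zero_le_one⟩).1
    exact (norm_nonneg _).trans h1
  -- the door's `hJ` carries `re` inside the double sum
  have hJ' : ‖iteratedFDeriv ℝ j (evalM (symInterp L (fun kv : TorusSite 2 L =>
      (∑ σ : Fin 2, ∑ i ∈ ({omega0 M, (omega0 M).rev} : Finset (MatsubaraIdx M)), (-((((β * (L : ℝ) ^ 2) : ℝ) : ℂ) * ((((fsub (klFlowFrameU L M β U μ (m + 1)) (klFlowFrameU L M β U μ m)).eval (latticeMomentum L kv) / (β * (L : ℝ) ^ 2) : ℝ) : ℂ)) ^ 2 * (uvSymbolCT L M β μ (klFlowFrameU L M β U μ (m + 1)) (klScale klE0 m) ((i, kv), σ) / (1 + uvSymbolCT L M β μ (klFlowFrameU L M β U μ (m + 1)) (klScale klE0 m) ((i, kv), σ) * (((fsub (klFlowFrameU L M β U μ (m + 1)) (klFlowFrameU L M β U μ m)).eval (latticeMomentum L kv) / (β * (L : ℝ) ^ 2) : ℝ) : ℂ)))) +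
        ((1 - ((((fsub (klFlowFrameU L M β U μ (m + 1)) (klFlowFrameU L M β U μ m)).eval (latticeMomentum L kv) / (β * (L : ℝ) ^ 2) : ℝ) : ℂ)) * (uvSymbolCT L M β μ (klFlowFrameU L M β U μ (m + 1)) (klScale klE0 m) ((i, kv), σ) / (1 + uvSymbolCT L M β μ (klFlowFrameU L M β U μ (m + 1)) (klScale klE0 m) ((i, kv), σ) * (((fsub (klFlowFrameU L M β U μ (m + 1)) (klFlowFrameU L M β U μ m)).eval (latticeMomentum L kv) / (β * (L : ℝ) ^ 2) : ℝ) : ℂ)))) ^ 2 - 1) * selfEnergy L M β (effAction ℂ (normalCovariance L M (fun ks => uvSymbolCT L M β μ (klFlowFrameU L M β U μ (m + 1)) (klScale klE0 m) ks / (1 + uvSymbolCT L M β μ (klFlowFrameU L M β U μ (m + 1)) (klScale klE0 m) ks * (((fsub (klFlowFrameU L M β U μ (m + 1)) (klFlowFrameU L M β U μ m)).eval (latticeMomentum L ks.1.2) / (β * (L : ℝ) ^ 2) : ℝ) : ℂ)))) (hubbardInteraction L M β U + counterQuadratic L M β (klFlowFrameU L M β U μ m))) (i, kv) σ).re) / 4)))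 q‖ ≤
      2 * (({omega0 M, (omega0 M).rev} : Finset (MatsubaraIdx M))).card * ((2 * (2 * ((1 / 4 : ℝ) * ((3 : ℝ) ^ j * Da * (2 / ((2 * (L / 4 + 1) : ℕ) : ℝ)) ^ (Md - j - 4) * (2 ^ 2 * ∑' k : Fin 2 → ℤ, ∏ c, (1 + (k c : ℝ) ^ 2)⁻¹)))) + (L : ℝ) ^ 2 * (L : ℝ) ^ j * (Aa * ((1 / 4 : ℝ) / (1 + (L : ℝ) / 4) ^ s))) +
        (2 * (2 * ((1 / 4 * Sj') * ((3 : ℝ) ^ j * Db * (2 / ((2 * (L / 4 + 1) : ℕ) : ℝ)) ^ (Md - j - 4) * (2 ^ 2 * ∑' k : Fin 2 → ℤ, ∏ c, (1 + (k c : ℝ) ^ 2)⁻¹)))) + (L : ℝ) ^ 2 * (L : ℝ) ^ j * (Ab * ((1 / 4 * Ss') / (1 + (L : ℝ) / 4) ^ s)))) := by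
    have hfun : (fun kv : TorusSite 2 L =>
        (∑ σ : Fin 2, ∑ i ∈ ({omega0 M, (omega0 M).rev} : Finset (MatsubaraIdx M)), (-((((β * (L : ℝ) ^ 2) : ℝ) : ℂ) * ((((fsub (klFlowFrameU L M β U μ (m + 1)) (klFlowFrameU L M β U μ m)).eval (latticeMomentum L kv) / (β * (L : ℝ) ^ 2) : ℝ) : ℂ)) ^ 2 * (uvSymbolCT L M β μ (klFlowFrameU L M β U μ (m + 1)) (klScale klE0 m) ((i, kv), σ) / (1 + uvSymbolCT L M β μ (klFlowFrameU L M β U μ (m + 1)) (klScale klE0 m) ((i, kv), σ) * (((fsub (klFlowFrameU L M β U μ (m + 1)) (klFlowFrameU L M β U μ m)).eval (latticeMomentum L kv) / (β * (L : ℝ) ^ 2) : ℝ) : ℂ)))) +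
          ((1 - ((((fsub (klFlowFrameU L M β U μ (m + 1)) (klFlowFrameU L M β U μ m)).eval (latticeMomentum L kv) / (β * (L : ℝ) ^ 2) : ℝ) : ℂ)) * (uvSymbolCT L M β μ (klFlowFrameU L M β U μ (m + 1)) (klScale klE0 m) ((i, kv), σ) / (1 + uvSymbolCT L M β μ (klFlowFrameU L M β U μ (m + 1)) (klScale klE0 m) ((i, kv), σ) * (((fsub (klFlowFrameU L M β U μ (m + 1)) (klFlowFrameU L M β U μ m)).eval (latticeMomentum L kv) / (β * (L : ℝ) ^ 2) : ℝ) : ℂ)))) ^ 2 - 1) * selfEnergy L M β (effAction ℂ (normalCovariance L M (fun ks => uvSymbolCT L M β μ (klFlowFrameU L M β U μ (m + 1)) (klScale klE0 m) ks / (1 + uvSymbolCT L M β μ (klFlowFrameU L M β U μ (m + 1)) (klScale klE0 m) ks * (((fsub (klFlowFrameU L M β U μ (m + 1)) (klFlowFrameU L M β U μ m)).eval (latticeMomentum L ks.1.2) / (β * (L : ℝ) ^ 2) : ℝ) : ℂ)))) (hubbardInteraction L M β U + counterQuadratic L M β (klFlowFrameU L M β U μ m))) (i, kv) σ).re) / 4)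 =
        fun kv : TorusSite 2 L =>
        (∑ σ : Fin 2, ∑ i ∈ ({omega0 M, (omega0 M).rev} : Finset (MatsubaraIdx M)), (-((((β * (L : ℝ) ^ 2) : ℝ) : ℂ) * ((((fsub (klFlowFrameU L M β U μ (m + 1)) (klFlowFrameU L M β U μ m)).eval (latticeMomentum L kv) / (β * (L : ℝ) ^ 2) : ℝ) : ℂ)) ^ 2 * (uvSymbolCT L M β μ (klFlowFrameU L M β U μ (m + 1)) (klScale klE0 m) ((i, kv), σ) / (1 + uvSymbolCT L M β μ (klFlowFrameU L M β U μ (m + 1)) (klScale klE0 m) ((i, kv), σ) * (((fsub (klFlowFrameU L M β U μ (m + 1)) (klFlowFrameU L M β U μ m)).eval (latticeMomentum L kv) / (β * (L : ℝ) ^ 2) : ℝ) : ℂ)))) +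
          ((1 - ((((fsub (klFlowFrameU L M β U μ (m + 1)) (klFlowFrameU L M β U μ m)).eval (latticeMomentum L kv) / (β * (L : ℝ) ^ 2) : ℝ) : ℂ)) * (uvSymbolCT L M β μ (klFlowFrameU L M β U μ (m + 1)) (klScale klE0 m) ((i, kv), σ) / (1 + uvSymbolCT L M β μ (klFlowFrameU L M β U μ (m + 1)) (klScale klE0 m) ((i, kv), σ) * (((fsub (klFlowFrameU L M β U μ (m + 1)) (klFlowFrameU L M β U μ m)).eval (latticeMomentum L kv) / (β * (L : ℝ) ^ 2) : ℝ) : ℂ)))) ^ 2 - 1) * selfEnergy L M β (effAction ℂ (normalCovariance L M (fun ks => uvSymbolCT L M β μ (klFlowFrameU L M β U μ (m + 1)) (klScale klE0 m) ks / (1 + uvSymbolCT L M β μ (klFlowFrameU L M β U μ (m + 1)) (klScale klE0 m) ks * (((fsub (klFlowFrameU L M β U μ (m + 1)) (klFlowFrameU L M β U μ m)).eval (latticeMomentum L ks.1.2) / (β * (L : ℝ) ^ 2) : ℝ) : ℂ)))) (hubbardInteraction L M β U + counterQuadratic L M β (klFlowFrameU L M β U μ m))) (i, kv) σ)).re / 4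 := by
      funext kv; simp only [Complex.re_sum]
    rw [hfun]
    exact hJ
  refine norm_iteratedFDeriv_klLocSelfEnergyRe_flowFrame_sub_le_pure hβ U μ m hOK₁ hOK₂ hB0 hB hfdist hfd hZ₂ hZ j q hN0 hA0 hA0 hN hT (hJ'.trans ?_)
  -- nonnegativity of the bracket, then `card ≤ 2`
  have hi0 : omega0 M ∈ ({omega0 M, (omega0 M).rev} : Finset (MatsubaraIdx M)) := by simp
  have hDa0 : 0 ≤ Da := (norm_nonneg _).trans (hDa (omega0 M) hi0 q)
  have hAa0 : 0 ≤ Aa := (norm_nonneg _).trans (hAa (omega0 M) hi0 q)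
  have hDb0 : 0 ≤ Db := (norm_nonneg _).trans (hDb (omega0 M) hi0 q)
  have hAb0 : 0 ≤ Ab := (norm_nonneg _).trans (hAb (omega0 M) hi0 q)
  have hw0 : ∀ (r : ℕ) (f : TorusSite 2 L → ℂ), 0 ≤ ∑ x : TorusSite 2 L, (1 + ((x 0).valMinAbs.natAbs : ℝ) + ((x 1).valMinAbs.natAbs : ℝ)) ^ r * ‖torusFourierInv f x‖ :=
    fun r f => sum_nonneg fun x _ => mul_nonneg (by positivity) (norm_nonneg _)
  have hSj0 : 0 ≤ Sj' := (hw0 _ _).trans (hSE (omega0 M) hi0 0).1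
  have hSs0 : 0 ≤ Ss' := (hw0 _ _).trans (hSE (omega0 M) hi0 0).2
  have hC2 : 0 ≤ ∑' k : Fin 2 → ℤ, ∏ c, (1 + (k c : ℝ) ^ 2)⁻¹ := tsum_nonneg fun k => prod_nonneg fun c _ => by positivity
  have hr0 : 0 ≤ (2 / ((2 * (L / 4 + 1) : ℕ) : ℝ)) ^ (Md - j - 4) := by positivity
  have hGa : 0 ≤ ((3 : ℝ) ^ j * Da * (2 / ((2 * (L / 4 + 1) : ℕ) : ℝ)) ^ (Md - j - 4) * (2 ^ 2 * ∑' k : Fin 2 → ℤ, ∏ c, (1 + (k c : ℝ) ^ 2)⁻¹)) := mul_nonneg (mul_nonneg (mul_nonneg (by positivity) hDa0) hr0) (mul_nonneg (by norm_num) hC2)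
  have hGb : 0 ≤ ((3 : ℝ) ^ j * Db * (2 / ((2 * (L / 4 + 1) : ℕ) : ℝ)) ^ (Md - j - 4) * (2 ^ 2 * ∑' k : Fin 2 → ℤ, ∏ c, (1 + (k c : ℝ) ^ 2)⁻¹)) := mul_nonneg (mul_nonneg (mul_nonneg (by positivity) hDb0) hr0) (mul_nonneg (by norm_num) hC2)
  have hLs : 0 ≤ (1 + (L : ℝ) / 4) ^ s := by positivity
  have hnn : 0 ≤ ((2 * (2 * ((1 / 4 : ℝ) * ((3 : ℝ) ^ j * Da * (2 / ((2 * (L / 4 + 1) : ℕ) : ℝ)) ^ (Md - j - 4) * (2 ^ 2 * ∑' k : Fin 2 → ℤ, ∏ c, (1 + (k c : ℝ) ^ 2)⁻¹)))) + (L : ℝ) ^ 2 * (L : ℝ) ^ j * (Aa * ((1 / 4 : ℝ) / (1 + (L : ℝ) / 4) ^ s))) +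
      (2 * (2 * ((1 / 4 * Sj') * ((3 : ℝ) ^ j * Db * (2 / ((2 * (L / 4 + 1) : ℕ) : ℝ)) ^ (Md - j - 4) * (2 ^ 2 * ∑' k : Fin 2 → ℤ, ∏ c, (1 + (k c : ℝ) ^ 2)⁻¹)))) + (L : ℝ) ^ 2 * (L : ℝ) ^ j * (Ab * ((1 / 4 * Ss') / (1 + (L : ℝ) / 4) ^ s)))) :=
    add_nonneg
      (add_nonneg (mul_nonneg (by norm_num) (mul_nonneg (by norm_num) (mul_nonneg (by norm_num) hGa)))
        (mul_nonneg (by positivity) (mul_nonneg hAa0 (div_nonneg (by norm_num) hLs))))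
      (add_nonneg (mul_nonneg (by norm_num) (mul_nonneg (by norm_num) (mul_nonneg (mul_nonneg (by norm_num) hSj0) hGb)))
        (mul_nonneg (by positivity) (mul_nonneg hAb0 (div_nonneg (mul_nonneg (by norm_num) hSs0) hLs))))
  exact mul_le_mul_of_nonneg_right (mul_le_mul_of_nonneg_left hcard (by norm_num)) hnn

end Flow

end Summit.HubbardSuperconductivity.HubbardSuperconductivity.Theorems.EngineV8

end
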